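import Mathlib

/-!
# Digit designs of `cw₂^{⊠N}` in elementary abelian `2`-groups need order at least `4^N`

Setting as in `SoloInformedCwTwoAPDigits` (soloist door D6): by rigidity, a weighted group
realization of the support `S_N` of `cw₂^{⊠N}` in an abelian group `B` is a system of digit maps
`f_k : Fin 3 → B`, `f_k 0 = 0`, together with additive real weights `α_k : Fin 3 → ℝ`, `α_k 0 = 0`,
such that every triple of words `(u,v,w)` with `Σ_k (f_k u_k + f_k v_k + f_k w_k) = Σ_k (f_k 1 + f_k 2)`
and some coordinate at which `u_k, v_k, w_k` are not pairwise distinct has positive excess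
`Σ_k (α_k u_k + α_k v_k + α_k w_k − α_k 1 − α_k 2)` (hypothesis `H`).

**Theorem (new here; partial no-go (a) for door D6).**  If `B` has exponent `2`
(`∀ b, b + b = 0`), then for EVERY choice of digits and weights the `2N` elements
`f_k 1, f_k 2` are `𝔽₂`-independent: the map `c ↦ Σ_k (c_k.1 • f_k 1 + c_k.2 • f_k 2)` is injective
on `({0,1} × {0,1})^N` (`charTwoDigits_injective`), hence `4^N ≤ |B|` (`four_pow_le_card_of_charTwo`).
So the exact designs in `(ℤ/2)^{2N}` (products of the Klein-four-group realization of `cw₂`,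
Alman–Vassilevska Williams, arXiv:1810.08671, Thm. 7.2) are optimal among all elementary abelian
`2`-groups, weighted or not: this host family can never certify `R̲(cw₂^{⊠N}) < 4^N`.

Proof: in characteristic `2` every non-zero element `x p_k + y q_k` of the digit plane is the
group excess of TWO patterns with OPPOSITE real excess (`p`: `112`/`002`; `q`: `122`/`001`;
`p+q`: `011`/`022`), so a non-trivial relation `Σ_k (x_k p_k + y_k q_k) = 0` yields two admissible
off-support triples with excesses `E` and `−E`, contradicting `H`.

No `sorry`; axioms `propext`, `Classical.choice`, `Quot.sound`.
-/

namespace Summit.MatrixMultiplication.MatrixMultiplication.Theorems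

open Finset

section CwTwoCharTwo

variable {B : Type*} [AddCommGroup B] {N : ℕ}

/-- The `+` pattern attached to a pair of bits `(x,y)`: `(0,0) ↦ 012`, `(1,0) ↦ 112`,
`(0,1) ↦ 122`, `(1,1) ↦ 011`. -/
def c2PatPos (x y : Bool) : Fin 3 × Fin 3 × Fin 3 :=
  match x, y with
  | false, false => (0, 1, 2)
  | true, false => (1, 1, 2)
  | false, true => (1, 2, 2)
  | true, true => (0, 1, 1)

/-- The `−` pattern attached to a pair of bits `(x,y)`: `(0,0) ↦ 012`, `(1,0) ↦ 002`,
`(0,1) ↦ 001`, `(1,1) ↦ 022`. -/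
def c2PatNeg (x y : Bool) : Fin 3 × Fin 3 × Fin 3 :=
  match x, y with
  | false, false => (0, 1, 2)
  | true, false => (0, 0, 2)
  | false, true => (0, 0, 1)
  | true, true => (0, 2, 2)

/-- In a group of exponent `2`, `a = b ↔ a + b = 0`. -/
theorem char2_eq_iff (h2 : ∀ b : B, b + b = 0) (a b : B) : a = b ↔ a + b = 0 := by
  constructor
  · rintro rfl; exact h2 a
  · intro h
    have hb : -b = b := by rw [neg_eq_iff_add_eq_zero]; exact h2 b
    rw [add_eq_zero_iff_eq_neg] at h; rw [h]; exact hb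

/-- Letter sums of both patterns: `p + q + (x p + y q)` in characteristic `2`. -/
theorem c2Pat_sum (h2 : ∀ b : B, b + b = 0) (f : Fin 3 → B) (hf : f 0 = 0) (x y : Bool) :
    f (c2PatPos x y).1 + f (c2PatPos x y).2.1 + f (c2PatPos x y).2.2 =
      f 1 + f 2 + ((if x = true then f 1 else 0) + (if y = true then f 2 else 0)) ∧
    f (c2PatNeg x y).1 + f (c2PatNeg x y).2.1 + f (c2PatNeg x y).2.2 =
      f 1 + f 2 + ((if x = true then f 1 else 0) + (if y = true then f 2 else 0)) := by
  have h2z : ∀ b : B, (2:ℤ) • b = 0 := fun b => by rw [two_zsmul]; exact h2 b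
  have h4z : ∀ b : B, (4:ℤ) • b = 0 := fun b => by
    rw [show (4:ℤ) = 2 + 2 by norm_num, add_zsmul, h2z, add_zero]
  cases x <;> cases y <;> refine ⟨?_, ?_⟩ <;>
    simp only [c2PatPos, c2PatNeg, hf, Bool.false_eq_true, if_false, if_true, add_zero, zero_add] <;>
    (rw [char2_eq_iff h2]; abel_nf; simp [h2z, h4z])

/-- The two patterns have opposite real excess. -/
theorem c2Pat_excess (α : Fin 3 → ℝ) (h0 : α 0 = 0) (x y : Bool) :
    α (c2PatNeg x y).1 + α (c2PatNeg x y).2.1 + α (c2PatNeg x y).2.2 - (α 1 + α 2) =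
      -(α (c2PatPos x y).1 + α (c2PatPos x y).2.1 + α (c2PatPos x y).2.2 - (α 1 + α 2)) := by
  cases x <;> cases y <;> simp [c2PatPos, c2PatNeg, h0]

/-- Off-support: if `(x,y) ≠ (0,0)` both patterns repeat a letter. -/
theorem c2Pat_not_distinct (x y : Bool) (hxy : x = true ∨ y = true) :
    ((c2PatPos x y).1 = (c2PatPos x y).2.1 ∨ (c2PatPos x y).2.1 = (c2PatPos x y).2.2 ∨
      (c2PatPos x y).1 = (c2PatPos x y).2.2) ∧
    ((c2PatNeg x y).1 = (c2PatNeg x y).2.1 ∨ (c2PatNeg x y).2.1 = (c2PatNeg x y).2.2 ∨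
      (c2PatNeg x y).1 = (c2PatNeg x y).2.2) := by
  rcases hxy with h | h <;> subst h <;> [cases y; cases x] <;> decide

/-- In characteristic `2`, `a • p + a' • p = [a ≠ a'] • p` for bits `a, a'`. -/
theorem fin2_smul_add_smul (h2 : ∀ b : B, b + b = 0) (p : B) (a a' : Fin 2) :
    (a.val • p + a'.val • p : B) = if decide (a ≠ a') = true then p else 0 := by
  fin_cases a <;> fin_cases a' <;> simp [h2 p]

/-- **Digit designs in exponent-`2` groups are `4^N`-injective.**  See the module docstring. -/
theorem charTwoDigits_injective (h2 : ∀ b : B, b + b = 0) (f : Fin N → Fin 3 → B)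
    (hf : ∀ k, f k 0 = 0) (α : Fin N → Fin 3 → ℝ) (hα : ∀ k, α k 0 = 0)
    (H : ∀ u v w : Fin N → Fin 3,
      (∑ k, (f k (u k) + f k (v k) + f k (w k))) = ∑ k, (f k 1 + f k 2) →
      (∃ k, u k = v k ∨ v k = w k ∨ u k = w k) →
      0 < ∑ k, (α k (u k) + α k (v k) + α k (w k) - (α k 1 + α k 2))) :
    Function.Injective
      (fun c : Fin N → Fin 2 × Fin 2 => ∑ k, ((c k).1.val • f k 1 + (c k).2.val • f k 2)) := by
  classical
  intro c c' hcc'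
  dsimp only at hcc'
  by_contra hne
  obtain ⟨k₀, hk₀⟩ := Function.ne_iff.mp hne
  -- the bits of the difference
  obtain ⟨x, hx⟩ : ∃ x : Fin N → Bool, ∀ k, x k = decide ((c k).1 ≠ (c' k).1) := ⟨_, fun _ => rfl⟩
  obtain ⟨y, hy⟩ : ∃ y : Fin N → Bool, ∀ k, y k = decide ((c k).2 ≠ (c' k).2) := ⟨_, fun _ => rfl⟩
  have hrel : (∑ k, ((if x k = true then f k 1 else 0) + (if y k = true then f k 2 else 0))) = 0 := by
    have hsum : (∑ k, ((c k).1.val • f k 1 + (c k).2.val • f k 2)) +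
        ∑ k, ((c' k).1.val • f k 1 + (c' k).2.val • f k 2) = 0 := by
      rw [hcc']; exact h2 _
    rw [← Finset.sum_add_distrib] at hsum
    refine (Finset.sum_congr rfl (fun k _ => ?_)).trans hsum
    rw [hx k, hy k, ← fin2_smul_add_smul h2 (f k 1) (c k).1 (c' k).1,
      ← fin2_smul_add_smul h2 (f k 2) (c k).2 (c' k).2]
    abel
  have hx0 : x k₀ = true ∨ y k₀ = true := by
    rw [hx k₀, hy k₀, decide_eq_true_iff, decide_eq_true_iff]
    by_contra hcon
    push Not at hcon
    exact hk₀ (Prod.ext hcon.1 hcon.2)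
  -- the two triples
  have hyp : ∀ (pat : Bool → Bool → Fin 3 × Fin 3 × Fin 3),
      (∀ k, f k (pat (x k) (y k)).1 + f k (pat (x k) (y k)).2.1 + f k (pat (x k) (y k)).2.2 =
        f k 1 + f k 2 + ((if x k = true then f k 1 else 0) + (if y k = true then f k 2 else 0))) →
      (∑ k, (f k (pat (x k) (y k)).1 + f k (pat (x k) (y k)).2.1 + f k (pat (x k) (y k)).2.2)) =
        ∑ k, (f k 1 + f k 2) := by
    intro pat hpat
    rw [Finset.sum_congr rfl (fun k _ => hpat k), Finset.sum_add_distrib, hrel, add_zero]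
  have hpos := H (fun k => (c2PatPos (x k) (y k)).1) (fun k => (c2PatPos (x k) (y k)).2.1)
    (fun k => (c2PatPos (x k) (y k)).2.2)
    (hyp c2PatPos (fun k => (c2Pat_sum h2 (f k) (hf k) (x k) (y k)).1))
    ⟨k₀, (c2Pat_not_distinct (x k₀) (y k₀) hx0).1⟩
  have hneg := H (fun k => (c2PatNeg (x k) (y k)).1) (fun k => (c2PatNeg (x k) (y k)).2.1)
    (fun k => (c2PatNeg (x k) (y k)).2.2)
    (hyp c2PatNeg (fun k => (c2Pat_sum h2 (f k) (hf k) (x k) (y k)).2))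
    ⟨k₀, (c2Pat_not_distinct (x k₀) (y k₀) hx0).2⟩
  have hopp : (∑ k, (α k (c2PatNeg (x k) (y k)).1 + α k (c2PatNeg (x k) (y k)).2.1 +
      α k (c2PatNeg (x k) (y k)).2.2 - (α k 1 + α k 2))) =
      -∑ k, (α k (c2PatPos (x k) (y k)).1 + α k (c2PatPos (x k) (y k)).2.1 +
        α k (c2PatPos (x k) (y k)).2.2 - (α k 1 + α k 2)) := by
    rw [← Finset.sum_neg_distrib]
    exact Finset.sum_congr rfl (fun k _ => c2Pat_excess (α k) (hα k) (x k) (y k))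
  rw [hopp] at hneg
  linarith

/-- **Digit designs of `cw₂^{⊠N}` in exponent-`2` groups need `|B| ≥ 4^N`.** -/
theorem four_pow_le_card_of_charTwo [Fintype B] (h2 : ∀ b : B, b + b = 0)
    (f : Fin N → Fin 3 → B) (hf : ∀ k, f k 0 = 0) (α : Fin N → Fin 3 → ℝ) (hα : ∀ k, α k 0 = 0)
    (H : ∀ u v w : Fin N → Fin 3,
      (∑ k, (f k (u k) + f k (v k) + f k (w k))) = ∑ k, (f k 1 + f k 2) →
      (∃ k, u k = v k ∨ v k = w k ∨ u k = w k) →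
      0 < ∑ k, (α k (u k) + α k (v k) + α k (w k) - (α k 1 + α k 2))) :
    4 ^ N ≤ Fintype.card B := by
  classical
  have h := Fintype.card_le_of_injective _ (charTwoDigits_injective h2 f hf α hα H)
  simpa [Fintype.card_fun, Fintype.card_fin, Fintype.card_prod] using h

/-- The Klein-four-group digits of `cw₂`: `0 ↦ (0,0)`, `1 ↦ (1,0)`, `2 ↦ (0,1)`. -/
def kleinDigit (t : Fin 3) : ZMod 2 × ZMod 2 := if t = 1 then (1, 0) else if t = 2 then (0, 1) else 0

/-- **Non-vacuity and tightness at `N = 1`.**  The Klein-four-group realization of `cw₂`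
(digits `kleinDigit`, any weights with `α 0 = 0`, here `(0, ½, 0)`) satisfies hypothesis `H` of
`charTwoDigits_injective` — indeed exactly: every solution of the digit equation is a permutation
of `(0,1,2)` — and there `4^N = |B|`. -/
theorem charTwo_hypothesis_klein : ∀ u v w : Fin 1 → Fin 3,
    (∑ k, ((fun _ : Fin 1 => kleinDigit) k (u k) + (fun _ : Fin 1 => kleinDigit) k (v k) +
      (fun _ : Fin 1 => kleinDigit) k (w k))) =
      ∑ k, ((fun _ : Fin 1 => kleinDigit) k 1 + (fun _ : Fin 1 => kleinDigit) k 2) →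
    (∃ k, u k = v k ∨ v k = w k ∨ u k = w k) →
    0 < ∑ k, ((fun (_ : Fin 1) (t : Fin 3) => if t = 1 then (1/2 : ℝ) else 0) k (u k) +
      (fun (_ : Fin 1) (t : Fin 3) => if t = 1 then (1/2 : ℝ) else 0) k (v k) +
      (fun (_ : Fin 1) (t : Fin 3) => if t = 1 then (1/2 : ℝ) else 0) k (w k) -
      ((fun (_ : Fin 1) (t : Fin 3) => if t = 1 then (1/2 : ℝ) else 0) k 1 +
       (fun (_ : Fin 1) (t : Fin 3) => if t = 1 then (1/2 : ℝ) else 0) k 2)) := by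
  intro u v w hyp hns
  obtain ⟨k, hk⟩ := hns
  have hk0 : k = 0 := Subsingleton.elim _ _
  subst hk0
  simp only [Fin.sum_univ_one] at hyp ⊢
  generalize hua : u 0 = a at *
  generalize hvb : v 0 = b at *
  generalize hwc : w 0 = c at *
  fin_cases a <;> fin_cases b <;> fin_cases c <;> simp_all <;> revert hyp <;> decide

/-- The pipeline on the base case: `4 ^ 1 ≤ |ℤ/2 × ℤ/2|` through `four_pow_le_card_of_charTwo`. -/
theorem four_pow_one_le_card_klein : 4 ^ 1 ≤ Fintype.card (ZMod 2 × ZMod 2) :=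
  four_pow_le_card_of_charTwo (fun b => by
      obtain ⟨b1, b2⟩ := b
      ext <;> simp only [Prod.fst_add, Prod.snd_add, Prod.fst_zero, Prod.snd_zero] <;>
        [revert b1; revert b2] <;> decide)
    (fun _ : Fin 1 => kleinDigit) (fun _ => by simp [kleinDigit])
    (fun (_ : Fin 1) (t : Fin 3) => if t = 1 then (1/2 : ℝ) else 0) (fun _ => by simp)
    charTwo_hypothesis_klein

end CwTwoCharTwo

end Summit.MatrixMultiplication.MatrixMultiplication.Theorems
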